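import Mathlib
import HarnessLib
import Summits.ValiantsHypothesis.ValiantsHypothesis.Theses.MonotoneRestoration
import Summits.ValiantsHypothesis.ValiantsHypothesis.Theorems.MonotoneRestorationMonotoneRestorationQPEpsilonComplex
import Summits.ValiantsHypothesis.ValiantsHypothesis.Theorems.MonotoneRestorationQP.Negative.LoadBearing
import Literature.Computability.AlgebraicComplexity.DawarWilsenach2025
import Literature.Computability.AlgebraicComplexity.DawarWilsenach2025Thm71

/-!
# Skeleton — crux `MonotoneRestorationQP`, line `orbit-compression` (crux-strategist gen 1)

Crux item `stmt-ValiantsHypothesis-15886`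
(`Summit.ValiantsHypothesis.ValiantsHypothesis.Theses.MonotoneRestoration.MonotoneRestorationQP`).

After THEOREM ε (`monotoneRestorationQP_iff_complexRestorationQP`, p155888) the crux is literally
"every MATRIX-SYMMETRIC `VP` family over `ℂ` has square-symmetric circuits of quasi-polynomial
SIZE".  A square-symmetric circuit has two independent costs: its ORBIT SIZE `ORB(C)` (the largest
orbit of a gate under `Sym(Fin n)`, tree `LabelledArithCircuit.orbitSize`; by the Dawar–Wilsenach
support theorem this is the finite-model-theoretic content — polylog supports, counting width) and its
SIZE (the number of gates; the circuit-compression content).  Every lower-bound instrument in the tree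
(Dawar–Wilsenach Thm 6.4 / 7.1; `DawarWilsenach2025_thm71` is stated on `orbitSize`) sees only the
first.  This line cuts the crux along exactly that seam:

* `stub_orbitRestoration` (L1, ORBIT-FORM RESTORATION): every matrix-symmetric `VP` family over `ℂ` has,
  for every `n`, a square-symmetric circuit all of whose gate orbits have size `≤ 2^((log₂ n + c)^c)`
  (no bound on the number of gates).  Equivalent, via supports, to "no arithmetic CFI in characteristic
  0": the evaluation of a matrix-symmetric `VP` family at weighted graphs is `C^{polylog}`-invariant.
* `stub_orbitCompression` (L2, ORBIT-TO-SIZE COMPRESSION): a matrix-symmetric `VP` family that has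
  square-symmetric circuits with quasi-polynomial ORBITS also has square-symmetric circuits of
  quasi-polynomial SIZE.
* `MonotoneRestorationQP_of` : L1 → L2 → crux (THEOREM ε + composition), kernel-checked.
* Certified remarks (proved, not stubs): `crux_implies_orbitRestoration`, `crux_implies_orbitCompression`
  (so L1 ∧ L2 ⟺ crux: the cut loses nothing), and `orbitRestoration_decides` : L1 → `ValiantsHypothesis`
  (Dawar–Wilsenach Thm 7.1 is an ORBIT bound, so L1 ALONE already decides the summit — recorded for the
  route-level planners: L2 is load-bearing for the crux as filed but not for the summit).
-/

set_option linter.dupNamespace false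

namespace Summit.ValiantsHypothesis.ValiantsHypothesis.Cruxes.MonotoneRestorationQP.OrbitCompression

open Summit.ValiantsHypothesis.ValiantsHypothesis.Theses.MonotoneRestoration
open Summit.ValiantsHypothesis.ValiantsHypothesis.Theorems
open Literature.Computability.AlgebraicComplexity
open Filter

/-- **L1 — ORBIT-FORM RESTORATION (the finite-model-theory half of the crux).** Every family
`f_n ∈ ℂ[x_ij]` invariant under independent row and column permutations that is a `VP` family (tree
`IsVPFamily`) has, for every `n`, a square-symmetric labelled circuit over `ℂ` computing `f_n` whose
ORBIT SIZE (largest gate orbit under `Sym(Fin n)`, tree `orbitSize`) is `≤ 2^((log₂ n + c)^c)`; the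
number of gates is not bounded.  Strictly weaker than the crux (`orbitSize ≤ size`); necessary for it;
refuted by exactly the same witnesses (a matrix-symmetric `VP` family of counting width `ω(polylog n)`).
[conjecture-grade; cite: DawarWilsenach2025 Thm 6.4/7.1, DwivediPagoSeppelt2026 Outlook Q3] -/
theorem stub_orbitRestoration :
    ∀ f : (n : ℕ) → MvPolynomial (Fin n × Fin n) ℂ,
      (∀ (n : ℕ) (σ τ : Equiv.Perm (Fin n)),
        MvPolynomial.rename (fun p : Fin n × Fin n => (σ p.1, τ p.2)) (f n) = f n) →
      IsVPFamily f →
      ∃ c : ℕ, ∀ n : ℕ, ∃ (G : Type) (_ : Fintype G)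
        (C : LabelledArithCircuit ℂ (Fin n × Fin n) Unit G),
        C.IsSymmetric (Equiv.Perm (Fin n)) ∧ C.eval (C.output ()) = f n ∧
          C.orbitSize (Equiv.Perm (Fin n)) ≤ 2 ^ ((Nat.log 2 n + c) ^ c) := by
  sorry

/-- **L2 — ORBIT-TO-SIZE COMPRESSION (the circuit half of the crux).** A matrix-symmetric `VP` family
over `ℂ` that admits square-symmetric circuits with quasi-polynomial ORBIT size admits square-symmetric
circuits of quasi-polynomial SIZE.  Strictly weaker than the crux (extra hypothesis); the `VP`
hypothesis is load-bearing (a generic element of the span of exponentially many tree-hom polynomials has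
polynomial orbits and exponential circuit size); no lower-bound technique in the tree can refute it
(every instrument bounds orbits).  [conjecture-grade; cite: DawarWilsenach2025 §3.3, §6;
DawarPagoSeppelt2025 §5] -/
theorem stub_orbitCompression :
    ∀ f : (n : ℕ) → MvPolynomial (Fin n × Fin n) ℂ,
      (∀ (n : ℕ) (σ τ : Equiv.Perm (Fin n)),
        MvPolynomial.rename (fun p : Fin n × Fin n => (σ p.1, τ p.2)) (f n) = f n) →
      IsVPFamily f →
      (∃ c : ℕ, ∀ n : ℕ, ∃ (G : Type) (_ : Fintype G)
        (C : LabelledArithCircuit ℂ (Fin n × Fin n) Unit G),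
        C.IsSymmetric (Equiv.Perm (Fin n)) ∧ C.eval (C.output ()) = f n ∧
          C.orbitSize (Equiv.Perm (Fin n)) ≤ 2 ^ ((Nat.log 2 n + c) ^ c)) →
      ∃ c : ℕ, ∀ n : ℕ, ∃ (G : Type) (_ : Fintype G)
        (C : LabelledArithCircuit ℂ (Fin n × Fin n) Unit G),
        C.IsSymmetric (Equiv.Perm (Fin n)) ∧ C.eval (C.output ()) = f n ∧
          Fintype.card G ≤ 2 ^ ((Nat.log 2 n + c) ^ c) := by
  sorry

/-- **Composition.** L1 → L2 → `MonotoneRestorationQP`: THEOREM ε (complex form, landed p155888)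
turns the crux into complex matrix-symmetric restoration at quasi-polynomial SIZE, which is L2 fed by
L1. [folklore] -/
theorem MonotoneRestorationQP_of :
    (∀ f : (n : ℕ) → MvPolynomial (Fin n × Fin n) ℂ,
      (∀ (n : ℕ) (σ τ : Equiv.Perm (Fin n)),
        MvPolynomial.rename (fun p : Fin n × Fin n => (σ p.1, τ p.2)) (f n) = f n) →
      IsVPFamily f →
      ∃ c : ℕ, ∀ n : ℕ, ∃ (G : Type) (_ : Fintype G)
        (C : LabelledArithCircuit ℂ (Fin n × Fin n) Unit G),
        C.IsSymmetric (Equiv.Perm (Fin n)) ∧ C.eval (C.output ()) = f n ∧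
          C.orbitSize (Equiv.Perm (Fin n)) ≤ 2 ^ ((Nat.log 2 n + c) ^ c)) →
    (∀ f : (n : ℕ) → MvPolynomial (Fin n × Fin n) ℂ,
      (∀ (n : ℕ) (σ τ : Equiv.Perm (Fin n)),
        MvPolynomial.rename (fun p : Fin n × Fin n => (σ p.1, τ p.2)) (f n) = f n) →
      IsVPFamily f →
      (∃ c : ℕ, ∀ n : ℕ, ∃ (G : Type) (_ : Fintype G)
        (C : LabelledArithCircuit ℂ (Fin n × Fin n) Unit G),
        C.IsSymmetric (Equiv.Perm (Fin n)) ∧ C.eval (C.output ()) = f n ∧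
          C.orbitSize (Equiv.Perm (Fin n)) ≤ 2 ^ ((Nat.log 2 n + c) ^ c)) →
      ∃ c : ℕ, ∀ n : ℕ, ∃ (G : Type) (_ : Fintype G)
        (C : LabelledArithCircuit ℂ (Fin n × Fin n) Unit G),
        C.IsSymmetric (Equiv.Perm (Fin n)) ∧ C.eval (C.output ()) = f n ∧
          Fintype.card G ≤ 2 ^ ((Nat.log 2 n + c) ^ c)) →
    MonotoneRestorationQP := by
  intro h₁ h₂
  exact monotoneRestorationQP_iff_complexRestorationQP.mpr fun f hs hVP => h₂ f hs hVP (h₁ f hs hVP)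

/-- The crux from the two registered stubs (same composition, stubs discharged by name). [folklore] -/
theorem monotoneRestorationQP_of_stubs : MonotoneRestorationQP :=
  MonotoneRestorationQP_of stub_orbitRestoration stub_orbitCompression

/-! ### Certified remarks: the cut is exact, and L1 alone decides the summit -/

/-- crux ⇒ L1 (an orbit is a set of gates: `orbitSize ≤ size = card`). [folklore] -/
theorem crux_implies_orbitRestoration (h : MonotoneRestorationQP) :
    ∀ f : (n : ℕ) → MvPolynomial (Fin n × Fin n) ℂ,
      (∀ (n : ℕ) (σ τ : Equiv.Perm (Fin n)),
        MvPolynomial.rename (fun p : Fin n × Fin n => (σ p.1, τ p.2)) (f n) = f n) →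
      IsVPFamily f →
      ∃ c : ℕ, ∀ n : ℕ, ∃ (G : Type) (_ : Fintype G)
        (C : LabelledArithCircuit ℂ (Fin n × Fin n) Unit G),
        C.IsSymmetric (Equiv.Perm (Fin n)) ∧ C.eval (C.output ()) = f n ∧
          C.orbitSize (Equiv.Perm (Fin n)) ≤ 2 ^ ((Nat.log 2 n + c) ^ c) := by
  intro f hs hVP
  obtain ⟨c, hc⟩ := monotoneRestorationQP_iff_complexRestorationQP.mp h f hs hVP
  refine ⟨c, fun n => ?_⟩
  obtain ⟨G, inst, C, hsym, hev, hcard⟩ := hc n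
  refine ⟨G, inst, C, hsym, hev, le_trans ?_ hcard⟩
  exact C.orbitSize_le_size (Equiv.Perm (Fin n))

/-- crux ⇒ L2 (the conclusion of L2 is the conclusion of the complex form of the crux). [folklore] -/
theorem crux_implies_orbitCompression (h : MonotoneRestorationQP) :
    ∀ f : (n : ℕ) → MvPolynomial (Fin n × Fin n) ℂ,
      (∀ (n : ℕ) (σ τ : Equiv.Perm (Fin n)),
        MvPolynomial.rename (fun p : Fin n × Fin n => (σ p.1, τ p.2)) (f n) = f n) →
      IsVPFamily f →
      (∃ c : ℕ, ∀ n : ℕ, ∃ (G : Type) (_ : Fintype G)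
        (C : LabelledArithCircuit ℂ (Fin n × Fin n) Unit G),
        C.IsSymmetric (Equiv.Perm (Fin n)) ∧ C.eval (C.output ()) = f n ∧
          C.orbitSize (Equiv.Perm (Fin n)) ≤ 2 ^ ((Nat.log 2 n + c) ^ c)) →
      ∃ c : ℕ, ∀ n : ℕ, ∃ (G : Type) (_ : Fintype G)
        (C : LabelledArithCircuit ℂ (Fin n × Fin n) Unit G),
        C.IsSymmetric (Equiv.Perm (Fin n)) ∧ C.eval (C.output ()) = f n ∧
          Fintype.card G ≤ 2 ^ ((Nat.log 2 n + c) ^ c) :=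
  fun f hs hVP _ => monotoneRestorationQP_iff_complexRestorationQP.mp h f hs hVP

/-- The complex permanent is matrix-symmetric (any commutative semiring; cf. `rename_perm_perPoly`
for `ℝ≥0`). [folklore] -/
theorem rename_perm_perPoly_complex (n : ℕ) (σ τ : Equiv.Perm (Fin n)) :
    MvPolynomial.rename (fun p : Fin n × Fin n => (σ p.1, τ p.2)) (perPoly (Fin n) ℂ) =
      perPoly (Fin n) ℂ := by
  have h := congrArg (MvPolynomial.map (Complex.ofRealHom.comp NNReal.toRealHom))
    (MonotoneRestorationQP.Negative.rename_perm_perPoly n σ τ)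
  rw [MvPolynomial.map_rename, map_perPoly] at h
  exact h

/-- **L1 ALONE DECIDES THE SUMMIT.** Orbit-form restoration implies `VP ℂ ≠ VNP ℂ`: under
`VP = VNP` the permanent is a matrix-symmetric `VP` family (`perFamily_mem_VNP_holds`,
`mem_VP_ofFintype_iff_holds`), so L1 gives it square-symmetric circuits with orbits
`≤ 2^((log₂ n + c)^c)`, while Dawar–Wilsenach Thm 7.1 in its native ORBIT form
(`DawarWilsenach2025_thm71_holds`) gives orbits `≥ 2^(ε n)` infinitely often; polylog versus linear
(`polylog_pow_lt_linear`). Recorded for the route level: the SIZE half (L2) of the crux is not needed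
for the summit. [cite: DawarWilsenach2025, Thm. 7.1 (p. 18)] -/
theorem orbitRestoration_decides
    (h₁ : ∀ f : (n : ℕ) → MvPolynomial (Fin n × Fin n) ℂ,
      (∀ (n : ℕ) (σ τ : Equiv.Perm (Fin n)),
        MvPolynomial.rename (fun p : Fin n × Fin n => (σ p.1, τ p.2)) (f n) = f n) →
      IsVPFamily f →
      ∃ c : ℕ, ∀ n : ℕ, ∃ (G : Type) (_ : Fintype G)
        (C : LabelledArithCircuit ℂ (Fin n × Fin n) Unit G),
        C.IsSymmetric (Equiv.Perm (Fin n)) ∧ C.eval (C.output ()) = f n ∧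
          C.orbitSize (Equiv.Perm (Fin n)) ≤ 2 ^ ((Nat.log 2 n + c) ^ c)) :
    _root_.ValiantsHypothesis := by
  classical
  show VP ℂ ≠ VNP ℂ
  intro hEq
  -- VP = VNP puts the permanent family in VP
  have hVP : IsVPFamily (fun n => perPoly (Fin n) ℂ) := by
    have hper : perFamily ℂ ∈ VP ℂ := by
      rw [hEq]; exact perFamily_mem_VNP_holds ℂ
    exact (mem_VP_ofFintype_iff_holds _).1 hper
  obtain ⟨c, hc⟩ := h₁ (fun n => perPoly (Fin n) ℂ) rename_perm_perPoly_complex hVP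
  choose G inst C hCsymm hCeval hCorb using hc
  obtain ⟨ε, hε, hfreq⟩ := @DawarWilsenach2025_thm71_holds ℂ _ _ G inst C hCsymm hCeval
  obtain ⟨n₀, key⟩ := MonotoneRestorationQP.Negative.polylog_pow_lt_linear c hε
  obtain ⟨n, hle, hn⟩ := (hfreq.and_eventually (eventually_ge_atTop n₀)).exists
  have horb : (((C n).orbitSize (Equiv.Perm (Fin n)) : ℕ) : ℝ) ≤
      (2 : ℝ) ^ (((Nat.log 2 n + c) ^ c : ℕ) : ℝ) := by
    rw [Real.rpow_natCast]
    exact_mod_cast hCorb n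
  have hlt : (2 : ℝ) ^ (((Nat.log 2 n + c) ^ c : ℕ) : ℝ) < (2 : ℝ) ^ (ε * n) := by
    apply (Real.rpow_lt_rpow_left_iff one_lt_two).2
    have := key n hn
    push_cast at this ⊢
    exact this
  exact absurd (hle.trans horb) (not_le.mpr hlt)

end Summit.ValiantsHypothesis.ValiantsHypothesis.Cruxes.MonotoneRestorationQP.OrbitCompression
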